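import Literature.NumberTheory.QuadraticFields.SqrtNegTwoGrossencharakterChiFour
import Literature.NumberTheory.EllipticCurves.SqrtTwoTwistBrewerTheorem
import HarnessLib

/-!
# The algebraic Hecke character of the `j = 8000` curve `B₋₁ : y² = x³ − 4x² + 2x` (CM by `ℤ[√−2]`): infinity type `(1, 0)` and
# Deuring's Frobenius values — the row `j = 8000` of the Deuring print binder, base curve

Topic `Literature/NumberTheory/EllipticCurves`, namespace `Literature.NumberTheory.EllipticCurves.SqrtTwoTwist`.  THEOREMS ONLY (no definition,
no named fact, no `sorry`).  The `ℚ(√−2)` row of `Deuring_exists_heckeCharacter_of_maximalCM` (Silverman, *Advanced Topics* II Thm. 9.2,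
Cor. 10.4.1, Thm. 10.5, Ex. 2.30–2.32) for the base curve `B₋₁ = ⟨0, −4, 0, 2, 0⟩` of the family `B_n : y² = x³ + 4n x² + 2n² x`: the
tree's coefficientwise Deuring theorem `a_m(B_n) = (−n/m) · S(m)` (`lFunction_eq_jacobiSym_mul_primarySum`, Rajwade 1968 Thm. 1, UNCONDITIONAL
since Brewer's character sum is a theorem, `Brewer1961_characterSum_holds`) at `n = −1` reads `a_m(B₋₁) = S(m) = Σ_{x primary, N x = m} x`, and
the `ℤ[√−2]` Größencharakter datum `SqrtNegTwo.exists_heckeCharacter_of_eq_primarySum` (`ψ = heckeOfGross` of `𝔭 = (π) ↦ σ(π)`, `π` primary,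
modulo `(4√−2)`) turns it into an algebraic Hecke character of `K = ℚ(θ)`, `θ² = −2`:

* `lFunction_B_neg_one_eq_primarySum` — `a_p(B₋₁) = S(p)` in `ℤ[√−2]` at every prime `p`; `lFunction_B_one_eq_chiFour_mul_primarySum` —
  `a_p(B₁) = χ₄(p) S(p)` at every odd prime (`(−1/p) = χ₄(p)`);
* ★★★ `exists_heckeCharacter_B_neg_one` — over any quadratic `K ∋ θ`, `θ² = −2`, with non-trivial automorphism `c` and infinite place `w₀`:
  `ψ : HeckeCharacter K` of infinity type `(1, 0)` (clause (i)) such that at every `v ∣ p`, `p ≠ 2` (= the good primes of `B₋₁`, conductor `256`):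
  `ψ` is unramified, `ψ(ϖ_{c•v}) = conj ψ(ϖ_v)`, split `ψ(ϖ_v) + ψ(ϖ_{c•v}) = a_p(B₋₁)`, `ψ(ϖ_v) ψ(ϖ_{c•v}) = p`, inert `a_p(B₋₁) = 0`,
  `ψ(ϖ_v) = −p` (clause (iv)); ★★★ `exists_heckeCharacter_B_one` — the same for `B₁ : y² = x³ + 4x² + 2x` (`= B₋₁^{(−1)}`, the `256a1`-model),
  with the `χ₄`-twisted datum `SqrtNegTwo.psiFour` (the spine's twist layer only twists by discriminants prime to `2`, so both base curves are supplied).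

NOT here: clauses (iii), (v), the idelic equivariance and the other members `B_n` / the whole class `j = 8000` (quadratic twists: the spine's
`core_quadraticTwist_of_core`).  Nothing about BSD is proved here; no modularity is used.

## References
* A. R. Rajwade, *Arithmetic on curves with complex multiplication by √−2*, Proc. Cambridge Philos. Soc. 64 (1968), Thm. 1. [Rajwade1968]
* J. H. Silverman, *Advanced Topics in the Arithmetic of Elliptic Curves* (1994), II Thm. 9.2, Thm. 10.5, Ex. 2.30–2.32. [SilvermanATAEC1994]
* B. W. Brewer, *On certain character sums*, Trans. AMS 99 (1961). [Brewer1961]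

## Mathlib / tree search
Tree: `SqrtTwoTwist.{lFunction_eq_jacobiSym_mul_primarySum, Brewer1961_characterSum_holds}`, `SqrtNegTwo.{FieldData, exists_heckeCharacter_of_eq_primarySum}`,
`SqrtNegTwo.exists_heckeCharacter_of_eq_chiFour_mul_primarySum`, `SqrtNegTwoPrimary.primarySum`.  Mathlib: `jacobiSym.one_left`, `jacobiSym.at_neg_one`, `ZMod.χ₄`.
-/

noncomputable section

open scoped NumberTheorySymbols ComplexConjugate
open NumberField IsDedekindDomain

namespace Literature.NumberTheory.EllipticCurves

namespace SqrtTwoTwist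

open _root_.WeierstrassCurve Literature.NumberTheory.QuadraticFields Literature.NumberTheory.QuadraticFields.SqrtNegTwoPrimary
open Literature.NumberTheory.GaloisRepresentations (HeckeCharacter)

/-- The model `B₋₁ = ⟨0, −4, 0, 2, 0⟩` is the member `n = −1` of the family `⟨0, 4n, 0, 2n², 0⟩`. [cite: Rajwade1968, Thm. 1] -/
theorem B_neg_one_eq : (⟨0, -4, 0, 2, 0⟩ : WeierstrassCurve ℚ) = ⟨0, 4 * ((-1 : ℤ) : ℚ), 0, 2 * ((-1 : ℤ) : ℚ) ^ 2, 0⟩ := by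
  ext <;> norm_num

/-- ★ **`a_p(B₋₁) = S(p) = Σ_{x primary, N x = p} x` in `ℤ[√−2]`** at every prime `p` (indeed at every `m ≠ 0`; `(1/m) = 1`), UNCONDITIONALLY
(Rajwade's Theorem 1 with Brewer's sign theorem). [cite: Rajwade1968, Thm. 1] -/
theorem lFunction_B_neg_one_eq_primarySum {m : ℕ} (hm : m ≠ 0) :
    ((((⟨0, -4, 0, 2, 0⟩ : WeierstrassCurve ℚ).LFunction m : ℤ)) : ℤ√(-2)) = primarySum m := by
  have hsq : Squarefree (-1 : ℤ) := isUnit_one.neg.squarefree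
  have key := lFunction_eq_jacobiSym_mul_primarySum Brewer1961_characterSum_holds hsq (by decide) hm
  rw [neg_neg, jacobiSym.one_left, Int.cast_one, one_mul] at key
  rw [B_neg_one_eq]
  exact key

/-- ★★★ **Row `j = 8000`, base curve `B₋₁ : y² = x³ − 4x² + 2x` (`K = ℚ(√−2)`)**: clauses (i), (iv) (and (ii) prime by prime) of Deuring's
theorem, UNCONDITIONALLY — over any quadratic field `K ∋ θ` with `θ² = −2`, non-trivial automorphism `c` and infinite place `w₀` there is a Hecke
character `ψ` of `K` of infinity type `(1, 0)` such that at every prime `v ∣ p`, `p ≠ 2`: `ψ` is unramified at `v`, `ψ(ϖ_{c•v}) = conj ψ(ϖ_v)`,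
`c • v ≠ v → ψ(ϖ_v) + ψ(ϖ_{c•v}) = a_p(B₋₁) ∧ ψ(ϖ_v) ψ(ϖ_{c•v}) = p`, `c • v = v → a_p(B₋₁) = 0 ∧ ψ(ϖ_v) = −p`.
[cite: SilvermanATAEC1994, II Thm. 9.2 (a), Thm. 10.5 (b), Ex. 2.30 (b), (c)] [cite: Rajwade1968, Thm. 1] -/
theorem exists_heckeCharacter_B_neg_one (K : Type*) [Field K] [NumberField K] (h2 : Module.finrank ℚ K = 2) {θ : K}
    (hθ : θ ^ 2 = -2) {c : K ≃ₐ[ℚ] K} (hc : c ≠ 1) (w₀ : InfinitePlace K) :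
    ∃ ψ : HeckeCharacter K, ψ.HasInfinityType (fun _ => 1) (fun _ => 0) ∧
      ∀ (p : ℕ), p.Prime → p ≠ 2 → ∀ v : HeightOneSpectrum (𝓞 K), (p : 𝓞 K) ∈ v.asIdeal →
        ψ.IsUnramifiedAt v ∧ ψ.valueAtUniformizer (c • v) = conj (ψ.valueAtUniformizer v) ∧
        (c • v ≠ v → ψ.valueAtUniformizer v + ψ.valueAtUniformizer (c • v) =
            ((((⟨0, -4, 0, 2, 0⟩ : WeierstrassCurve ℚ).LFunction p : ℤ)) : ℂ) ∧
          ψ.valueAtUniformizer v * ψ.valueAtUniformizer (c • v) = p) ∧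
        (c • v = v → ((⟨0, -4, 0, 2, 0⟩ : WeierstrassCurve ℚ).LFunction p) = 0 ∧ ψ.valueAtUniformizer v = -(p : ℂ)) :=
  SqrtNegTwo.exists_heckeCharacter_of_eq_primarySum (SqrtNegTwo.FieldData.mk h2 hθ) hc w₀
    (fun p => (⟨0, -4, 0, 2, 0⟩ : WeierstrassCurve ℚ).LFunction p) fun _ hp _ => lFunction_B_neg_one_eq_primarySum hp.ne_zero

/-- The model `B₁ = ⟨0, 4, 0, 2, 0⟩` is the member `n = 1` of the family `⟨0, 4n, 0, 2n², 0⟩`. [cite: Rajwade1968, Thm. 1] -/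
theorem B_one_eq : (⟨0, 4, 0, 2, 0⟩ : WeierstrassCurve ℚ) = ⟨0, 4 * ((1 : ℤ) : ℚ), 0, 2 * ((1 : ℤ) : ℚ) ^ 2, 0⟩ := by
  ext <;> norm_num

/-- ★ **`a_p(B₁) = (−1/p) S(p) = χ₄(p) S(p)` in `ℤ[√−2]`** at every odd prime `p`, UNCONDITIONALLY (Rajwade's Theorem 1 at `n = 1` with Brewer's
theorem). [cite: Rajwade1968, Thm. 1] -/
theorem lFunction_B_one_eq_chiFour_mul_primarySum {p : ℕ} (hp : p.Prime) (hp2 : p ≠ 2) :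
    ((((⟨0, 4, 0, 2, 0⟩ : WeierstrassCurve ℚ).LFunction p : ℤ)) : ℤ√(-2)) = (ZMod.χ₄ (p : ZMod 4) : ℤ√(-2)) * primarySum p := by
  have hsq : Squarefree (1 : ℤ) := isUnit_one.squarefree
  have key := lFunction_eq_jacobiSym_mul_primarySum Brewer1961_characterSum_holds hsq odd_one hp.ne_zero
  rw [jacobiSym.at_neg_one (hp.odd_of_ne_two hp2)] at key
  rw [B_one_eq]
  exact key

/-- ★★★ **Row `j = 8000`, base curve `B₁ : y² = x³ + 4x² + 2x` (`256a1`-model, `= B₋₁^{(−1)}`, `K = ℚ(√−2)`)**: clauses (i), (iv) (and (ii)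
prime by prime) of Deuring's theorem, UNCONDITIONALLY — `ψ` of infinity type `(1, 0)` with, at every `v ∣ p`, `p ≠ 2`: `ψ` unramified,
`ψ(ϖ_{c•v}) = conj ψ(ϖ_v)`, split `ψ(ϖ_v) + ψ(ϖ_{c•v}) = a_p(B₁)`, `ψ(ϖ_v) ψ(ϖ_{c•v}) = p`, inert `a_p(B₁) = 0`, `ψ(ϖ_v) = −p` (`ψ = heckeOfGross` of
`SqrtNegTwo.psiFour`). [cite: SilvermanATAEC1994, II Thm. 9.2 (a), Thm. 10.5 (b), Ex. 2.30 (b), (c)] [cite: Rajwade1968, Thm. 1] -/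
theorem exists_heckeCharacter_B_one (K : Type*) [Field K] [NumberField K] (h2 : Module.finrank ℚ K = 2) {θ : K}
    (hθ : θ ^ 2 = -2) {c : K ≃ₐ[ℚ] K} (hc : c ≠ 1) (w₀ : InfinitePlace K) :
    ∃ ψ : HeckeCharacter K, ψ.HasInfinityType (fun _ => 1) (fun _ => 0) ∧
      ∀ (p : ℕ), p.Prime → p ≠ 2 → ∀ v : HeightOneSpectrum (𝓞 K), (p : 𝓞 K) ∈ v.asIdeal →
        ψ.IsUnramifiedAt v ∧ ψ.valueAtUniformizer (c • v) = conj (ψ.valueAtUniformizer v) ∧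
        (c • v ≠ v → ψ.valueAtUniformizer v + ψ.valueAtUniformizer (c • v) =
            ((((⟨0, 4, 0, 2, 0⟩ : WeierstrassCurve ℚ).LFunction p : ℤ)) : ℂ) ∧
          ψ.valueAtUniformizer v * ψ.valueAtUniformizer (c • v) = p) ∧
        (c • v = v → ((⟨0, 4, 0, 2, 0⟩ : WeierstrassCurve ℚ).LFunction p) = 0 ∧ ψ.valueAtUniformizer v = -(p : ℂ)) :=
  SqrtNegTwo.exists_heckeCharacter_of_eq_chiFour_mul_primarySum (SqrtNegTwo.FieldData.mk h2 hθ) hc w₀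
    (fun p => (⟨0, 4, 0, 2, 0⟩ : WeierstrassCurve ℚ).LFunction p) fun _ hp hp2 => lFunction_B_one_eq_chiFour_mul_primarySum hp hp2

end SqrtTwoTwist

end Literature.NumberTheory.EllipticCurves

end
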